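import Mathlib
import Literature.RingTheory.TwoVariableSeries.Basic
import Literature.AlgebraicGeometry.Resolution.FormalShear
import Summits.ResolutionOfSingularities.ResolutionOfSingularities.Theorems.WeightedInvariantLocalWeightedDropMonicDescentPrepInvariance
import Summits.ResolutionOfSingularities.ResolutionOfSingularities.Theorems.WeightedInvariantLocalWeightedDropMonicDescentShear

/-!
# `WeightedInvariant.LocalWeightedDrop`, sub-stub N4″: tools for the graph-curve step of Σ** (pieces of T-5′/T-6′)

Crux item stmt-ResolutionOfSingularities-8899 `LocalWeightedDrop` (route `ResolutionOfSingularities/WeightedInvariant`), door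
`WeightedConstruction` stmt-ResolutionOfSingularities-0571.  [OURS · L1 W4.3, chain w43, lead prover; tools for pieces T-5′/T-6′ of `N4PRIME-PLAN.md`
(case (a″) of the strategy Σ**: shear by a graph curve, prepare, blow up `V(y, ũ₂)`).]

* `newtonSet_nonempty_of_not_isDoublePlane` — a reduced label has a non-empty scaled Newton set;
* `isPosition_shearLabel` — the `u₂`-shear of a position is a position (substitutions do not lower orders);
* `recentre_recentre_eq` — in characteristic 2 re-centrings compose ADDITIVELY: `recentre χ (recentre ψ₀ S) = recentre (ψ₀ + χ) S` (first components;
  second components are all `S₁`);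
* `isVertex_rowMin` — the lowest-row-leftmost point `(2ζ, 2ε)` is a vertex;
* `isPermissibleTwo_of_wellPrepared_of_recentre` — ROW TRANSFER (from `exists_low_row_of_recentre`, p486315): if a label `B` is well prepared and SOME
  re-centring of it has `V(y,u₂)` permissible, then `V(y,u₂)` is permissible for `B` itself.  Consequently (`isPermissibleTwo_prep_shear`) in case
  (a″) the prepared sheared label `prep (shearLabel h A)` has `V(y, ũ₂)` permissible — the curve move of Σ** is legal and `2β` drops by 2.
-/

set_option linter.dupNamespace false -- mandated namespace of this single-conjunct summit

noncomputable section

namespace Summit.ResolutionOfSingularities.ResolutionOfSingularities.Theorems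

namespace MonicDescent

open MvPowerSeries Literature.RingTheory.TwoVariableSeries Literature.AlgebraicGeometry.Resolution

variable {k : Type} [Field k]

/-- A label that is not a double plane has a non-empty scaled Newton set (`A₀ = A₁ = 0` is the double plane `r = 0`). -/
theorem newtonSet_nonempty_of_not_isDoublePlane {A₀ A₁ : MvPowerSeries (Fin 2) k} (h : ¬ IsDoublePlane A₀ A₁) :
    (newtonSet A₀ A₁).Nonempty := by
  by_contra hemp
  rw [Set.not_nonempty_iff_eq_empty] at hemp
  apply h
  refine ⟨0, ?_, ?_⟩
  · rw [mul_zero]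
    ext e
    rw [map_zero]
    by_contra hne
    have : (2 • e) ∈ newtonSet A₀ A₁ := Or.inr ⟨e, rfl, hne⟩
    rw [hemp] at this
    exact this
  · rw [zero_pow two_ne_zero]
    ext e
    rw [map_zero]
    by_contra hne
    have : e ∈ newtonSet A₀ A₁ := Or.inl hne
    rw [hemp] at this
    exact this

/-- The `u₂`-shear of a position is a position. -/
theorem isPosition_shearLabel (h : MvPowerSeries (Fin 2) k) {A₀ A₁ : MvPowerSeries (Fin 2) k} (hA : IsPosition A₀ A₁) :
    IsPosition (shear h A₀) (shear h A₁) := by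
  obtain ⟨h₀, h₁⟩ := hA
  constructor
  · rw [shear_eq]
    exact lt_of_lt_of_le h₀ (FormalShear.order_le_order_subst' _ (constantCoeff_shearFamily h) A₀)
  · rw [shear_eq]
    exact lt_of_lt_of_le h₁ (FormalShear.order_le_order_subst' _ (constantCoeff_shearFamily h) A₁)

/-- In characteristic 2 re-centrings compose additively (first components). -/
theorem recentre_recentre_eq [CharP k 2] {m : ℕ} (χ ψ₀ S₀ S₁ : MvPowerSeries (Fin m) k) :
    (recentre χ (recentre ψ₀ S₀ S₁).1 (recentre ψ₀ S₀ S₁).2).1 = (recentre (ψ₀ + χ) S₀ S₁).1 := by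
  rw [recentre_snd_eq]
  change S₀ + S₁ * ψ₀ + ψ₀ ^ 2 + S₁ * χ + χ ^ 2 = S₀ + S₁ * (ψ₀ + χ) + (ψ₀ + χ) ^ 2
  have h2 : (2 : MvPowerSeries (Fin m) k) = 0 := two_eq_zero
  linear_combination (-(ψ₀ * χ)) * h2

/-- The LOWEST-ROW-LEFTMOST point `(2ζ, 2ε)` of a point set is a vertex (weight `(1, 2ζ + 1)`). -/
theorem isVertex_rowMin {N : Set (Fin 2 →₀ ℕ)} {P : Fin 2 →₀ ℕ} (hP : P ∈ N) (h1 : P 1 = epsL N) (h0 : P 0 = zetaL N) :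
    IsVertex N P := by
  refine ⟨hP, fun i => if i = 0 then 1 else zetaL N + 1, fun i => by fin_cases i <;> simp, fun Q hQ hne => ?_⟩
  have hw : ∀ R : Fin 2 →₀ ℕ, Finsupp.weight (fun i : Fin 2 => if i = 0 then 1 else zetaL N + 1) R = R 0 + (zetaL N + 1) * R 1 := by
    intro R
    rw [Finsupp.weight_apply, Finsupp.sum_fintype _ _ (by simp)]
    simp [Fin.sum_univ_two]
    ring
  rw [hw, hw, h0, h1]
  have hQ1 := epsL_le hQ
  rcases Nat.lt_or_ge (epsL N) (Q 1) with hlt | hge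
  · nlinarith
  · have hQ1eq : Q 1 = epsL N := le_antisymm hge hQ1
    have hQ0 := zetaL_le hQ hQ1eq
    have hne0 : Q 0 ≠ zetaL N := by
      intro hh
      apply hne
      exact finsupp_fin2_ext (hh.trans h0.symm) (hQ1eq.trans h1.symm)
    rw [hQ1eq]
    omega

/-- ROW TRANSFER: a WELL-PREPARED label one of whose re-centrings has `V(y,u₂)` permissible has `V(y,u₂)` permissible itself
(in char 2; via `exists_low_row_of_recentre`). -/
theorem isPermissibleTwo_of_wellPrepared_of_recentre [CharP k 2] {B₀ B₁ χ : MvPowerSeries (Fin 2) k}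
    (hWP : WellPrepared B₀ B₁) (hperm : IsPermissibleTwo (recentre χ B₀ B₁).1 (recentre χ B₀ B₁).2) :
    IsPermissibleTwo B₀ B₁ := by
  rw [recentre_snd_eq] at hperm
  obtain ⟨hp₀, hp₁⟩ := hperm
  change ∀ d, coeff d (B₀ + B₁ * χ + χ ^ 2) ≠ 0 → 2 ≤ d 1 at hp₀
  refine ⟨fun d hd => ?_, hp₁⟩
  by_contra hlt
  push Not at hlt
  -- the lowest row of `N(B)` has height `≤ 1`; its leftmost point is an odd vertex
  have hne : (newtonSet B₀ B₁).Nonempty := ⟨d, Or.inl hd⟩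
  obtain ⟨P, hP, hP1, hP0⟩ := exists_eq_zetaL hne
  have hε : epsL (newtonSet B₀ B₁) ≤ 1 := le_trans (epsL_le (Or.inl hd)) (by omega)
  have hPodd : IsOdd B₀ B₁ P := hWP P (isVertex_rowMin hP hP1 hP0)
  rcases hPodd with ⟨e, rfl, he⟩ | ⟨hc, hi⟩
  · have := hp₁ e he
    simp only [Finsupp.smul_apply, smul_eq_mul] at hP1
    omega
  · obtain ⟨d', hd', hd'1⟩ := exists_low_row_of_recentre B₀ B₁ χ P hc hi (by omega)
      (fun q hq => by
        have hq1 := epsL_le (N := newtonSet B₀ B₁) (Or.inl hq)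
        rcases Nat.lt_or_ge (P 1) (q 1) with h | h
        · exact Or.inl h
        · have hq1eq : q 1 = epsL (newtonSet B₀ B₁) := by omega
          exact Or.inr ⟨by omega, by rw [hP0]; exact zetaL_le (Or.inl hq) hq1eq⟩)
      (fun a ha => Or.inl (by have := hp₁ a ha; omega))
    have := hp₀ d' hd'
    omega

/-- In case (a″) of Σ** the curve move is legal: if `h` is a graph-curve shear of `A` (`HasGraphCurve` witness) and `ψ` is a well-preparing
re-centring of the sheared label, then `V(y, ũ₂)` is permissible for the prepared sheared label. -/
theorem isPermissibleTwo_prep_shear [CharP k 2] {A₀ A₁ h ψ' ψ : MvPowerSeries (Fin 2) k}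
    (hperm : IsPermissibleTwo (recentre ψ' (shear h A₀) (shear h A₁)).1 (recentre ψ' (shear h A₀) (shear h A₁)).2)
    (hprep : IsPrepRecentring (shear h A₀) (shear h A₁) ψ) :
    IsPermissibleTwo (recentre ψ (shear h A₀) (shear h A₁)).1 (recentre ψ (shear h A₀) (shear h A₁)).2 := by
  obtain ⟨-, -, hWP, -⟩ := hprep
  refine isPermissibleTwo_of_wellPrepared_of_recentre (χ := ψ + ψ') hWP ?_
  -- `recentre (ψ + ψ') (recentre ψ S) = recentre (ψ + (ψ + ψ')) S = recentre ψ' S` in characteristic 2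
  have h1 : (recentre (ψ + ψ') (recentre ψ (shear h A₀) (shear h A₁)).1 (recentre ψ (shear h A₀) (shear h A₁)).2).1 =
      (recentre ψ' (shear h A₀) (shear h A₁)).1 := by
    rw [recentre_recentre_eq]
    change shear h A₀ + shear h A₁ * (ψ + (ψ + ψ')) + (ψ + (ψ + ψ')) ^ 2 = shear h A₀ + shear h A₁ * ψ' + ψ' ^ 2
    have h2 : (2 : MvPowerSeries (Fin 2) k) = 0 := two_eq_zero
    linear_combination (shear h A₁ * ψ + 2 * ψ ^ 2 + 2 * ψ * ψ') * h2
  have h2c : (recentre (ψ + ψ') (recentre ψ (shear h A₀) (shear h A₁)).1 (recentre ψ (shear h A₀) (shear h A₁)).2).2 =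
      (recentre ψ' (shear h A₀) (shear h A₁)).2 := by
    rw [recentre_snd_eq, recentre_snd_eq, recentre_snd_eq]
  rw [h1, h2c]
  exact hperm

end MonicDescent

end Summit.ResolutionOfSingularities.ResolutionOfSingularities.Theorems

end
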